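import Literature.Barriers.CriticalPhenomena.IsingTrivialityFromDimensionFourProofs
import Literature.Barriers.CriticalPhenomena.IsingTrivialityFromDimensionFourTwoFacts
import Literature.Probability.LatticeModels.HighDimTrivialityUrsellFourHolds
import HarnessLib

/-!
# Discharges of named facts of `IsingTrivialityFromDimensionFour.lean`

`Literature/Barriers/CriticalPhenomena/IsingTrivialityFromDimensionFourHolds.lean` —
proofs-only sibling of `IsingTrivialityFromDimensionFour.lean` (no definitions, no named
facts). Each theorem below closes a named fact `X : Prop` of that file as `X_holds : X` by
composing an ACCEPTED reduction theorem of the tree with the ACCEPTED unconditional `_holds`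
discharges of all of its hypotheses; nothing is re-proved and no statement is changed.
Recorded by the librarian sweep g25 (2026-08-16, pass 5c: facts dischargeable in one line from
the tree's own lemmas), so that the facts census, `#h21_route_deps` and the cone guardrail see
these facts as theorems.

Discharged here:

* `IsingTrivialityFromDimensionFour_holds` := `of_ursellFourSum_le`
  `aizenmanDuminilCopin_ursellFourSum_le_holds`
  (`IsingTrivialityFromDimensionFourTwoFacts.lean`).
* `criticalSmearedMGF_bound_four_nonneg_holds` := `of_printedBound`
  `aizenmanDuminilCopin_mgf_normalizedField_bound_abs_holds`
  (`IsingTrivialityFromDimensionFourProofs.lean`).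

## References

* [AizenmanCDM2020] — see `lean/references.bib` and the docstring of the fact in `IsingTrivialityFromDimensionFour.lean`.
* [AizenmanCMP1982] — see `lean/references.bib` and the docstring of the fact in `IsingTrivialityFromDimensionFour.lean`.
* [AizenmanDuminilCopinAnnals2021] — see `lean/references.bib` and the docstring of the fact in `IsingTrivialityFromDimensionFour.lean`.
* [DuminilCopinICM2022] — see `lean/references.bib` and the docstring of the fact in `IsingTrivialityFromDimensionFour.lean`.
* [FrohlichTrivialityNPB1982] — see `lean/references.bib` and the docstring of the fact in `IsingTrivialityFromDimensionFour.lean`.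
* [Panis2023Triviality] — see `lean/references.bib` and the docstring of the fact in `IsingTrivialityFromDimensionFour.lean`.
-/

namespace Literature.Barriers.CriticalPhenomena

/-- **Discharge of the named fact `IsingTrivialityFromDimensionFour`**
(`IsingTrivialityFromDimensionFour.lean`): Barrier `IsingTrivialityFromDimensionFour`. For
every `d ≥ 4` the critical nearest-neighbour Ising model on `ℤ^d` has NO non-Gaussian smeared
scaling limit: … — obtained as `of_ursellFourSum_le` applied to the tree's unconditional
discharge `aizenmanDuminilCopin_ursellFourSum_le_holds` of its hypothesis (reduction in
`IsingTrivialityFromDimensionFourTwoFacts.lean`).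
[cite: AizenmanDuminilCopinAnnals2021, §1.1]
[cite: AizenmanCDM2020, §8.1 eqs. (8.2), (8.4) and §10.1 eqs. (10.1)–(10.2)]
[cite: AizenmanCDM2020, Lemma 8.1 and eq. (8.2)]
[cite: AizenmanDuminilCopinAnnals2021, §1.3 (tree diagram bound, infrared bound, dimension count)]
[cite: AizenmanCDM2020, §8.1 eq. (8.5)]
[cite: DuminilCopinICM2022, §6.4]
[cite: AizenmanCMP1982]
[cite: FrohlichTrivialityNPB1982]
[cite: AizenmanDuminilCopinAnnals2021, Theorem 1.3 and Proposition 1.4]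
[cite: Panis2023Triviality, §1.1 (footnote)]
[cite: AizenmanCDM2020, §11 (1)]
[cite: AizenmanCDM2020, §6 and §11 (1)]
[cite: DuminilCopinICM2022, §6.1]
[cite: DuminilCopinICM2022, §6.5]
[cite: AizenmanDuminilCopinAnnals2021, Definition 1.1]
[cite: AizenmanDuminilCopinAnnals2021, §3.2 (closing remark) and §6 (Discussion after the mixing theorem)]
[cite: Panis2023Triviality, Theorem 1.2 and Corollary 1.11]
[cite: AizenmanDuminilCopinAnnals2021, §6.3 (p. 26)]
[cite: AizenmanDuminilCopinAnnals2021, Theorem 1.3 and Theorem 5.6]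
[cite: DuminilCopinICM2022, §5.2 ("When h=0 and β=β_c … this is also the case [AizDumSid15]
[cite: AizenmanDuminilCopinAnnals2021, Theorem 1.2 and Proposition 1.4]
[cite: AizenmanDuminilCopinAnnals2021, Theorem 1.3, Theorem 5.6 and §6.3]
[cite: AizenmanCDM2020, Theorem 2.2] -/
theorem IsingTrivialityFromDimensionFour_holds :
    IsingTrivialityFromDimensionFour :=
  Literature.Barriers.CriticalPhenomena.IsingTrivialityFromDimensionFour.of_ursellFourSum_le
    Literature.Probability.LatticeModels.aizenmanDuminilCopin_ursellFourSum_le_holds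

/-- **Discharge of the named fact `criticalSmearedMGF_bound_four_nonneg`**
(`IsingTrivialityFromDimensionFour.lean`): NAMED FACT — marginal triviality in `d = 4`, as the
printed proof establishes it and p. 6 uses it (Aizenman–Duminil-Copin 2021, Proposition 1.4
with §6.3): there exist `c, C > 0` such that for the n.n.f. … — obtained as `of_printedBound`
applied to the tree's unconditional discharge
`aizenmanDuminilCopin_mgf_normalizedField_bound_abs_holds` of its hypothesis (reduction in
`IsingTrivialityFromDimensionFourProofs.lean`).
[cite: AizenmanDuminilCopinAnnals2021, Proposition 1.4 (p. 6) with §6.3 (p. 26, "f vanishes outside [-r,r] -/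
theorem criticalSmearedMGF_bound_four_nonneg_holds :
    criticalSmearedMGF_bound_four_nonneg :=
  Literature.Barriers.CriticalPhenomena.criticalSmearedMGF_bound_four_nonneg.of_printedBound
    Literature.Probability.LatticeModels.aizenmanDuminilCopin_mgf_normalizedField_bound_abs_holds

end Literature.Barriers.CriticalPhenomena
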